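import Summits.Ventures.Crystal3D.StickySpheres.ContactGraph
import HarnessLib

/-!
# Removing and docking a ball: the two inductions on the number of balls

Venture `Crystal3D` (cell `pub-crystal3d`, seat p2), over `StickySpheres/ContactGraph.lean` (p3: `IsUnitPacking`,
`numContacts`, `coordination`, `maxContacts`; diameter-`1` balls, contact = distance `1`).

HONEST FRAMING. This file proves the COMBINATORIAL SKELETONS of two inductions used by the cell; the geometric /
enumerative inputs enter as explicit hypotheses and are NOT proved here.
1. `numContacts_eq_coordination_add` — removing ball `v` loses exactly `coordination x v` contacts
   (`C(x) = deg_x(v) + C(x ∘ v.succAbove)`); `numContacts_snoc` — docking a new ball `q` (at distance `≥ 1` from all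
   centres) gains exactly the number of centres at distance `1` from `q`.
2. `maxContacts_le_of_kmin` — the "kmin induction" (cell PLAN R12/R16, engine-2 LEMMAS §1(f), lead 04:29Z): if a
   bound `f` satisfies `f (n-1) + k₀ ≤ f n` for `n ≥ n₀`, holds for all `n < n₀`, and holds for every packing of
   `n ≥ n₀` balls in which EVERY ball has more than `k₀` contacts, then `C(n) ≤ f n` for all `n`. (With `k₀ = 5`,
   `f n = 6n − γ n^{2/3}`, this is why the surface LP may assume coordination `≥ 6`.)
3. `maxContacts_eq_of_enumeration` — the Bezdek–Khan induction (Contact numbers for sphere packings, 2018, Prop. 5.1)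
   made hypothesis-explicit: IF for each `n` in a range every packing of `n` balls with minimum coordination `≥ 3` and
   at least `3n − 6` contacts has exactly `3n − 6` contacts and an EXPOSED TRIANGLE (a docking point at distance `1`
   from three centres and `≥ 1` from all), and `3n − 6` is attained, THEN `C(n) = 3n − 6` on that range. The
   hypothesis is exactly what an exact, complete enumeration of the `≥ 3n − 6` stratum certifies (cell STEP-0/census);
   nothing here claims it.
-/

noncomputable section

open Finset
open scoped BigOperators

namespace Summit.Ventures.Crystal3D

variable {N : ℕ} {d : ℕ}

/-! ### 1. Removing a ball -/

section Removal

variable (x : Fin (N + 1) → EuclideanSpace ℝ (Fin d)) (v : Fin (N + 1))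

/-- The contact pairs of `x` not involving `v` are the images of the contact pairs of `x ∘ v.succAbove`. [folklore] -/
theorem contactPairs_filter_not_mem :
    (contactPairs x).filter (fun p => p.1 ≠ v ∧ p.2 ≠ v) =
      (contactPairs (x ∘ v.succAbove)).map
        ⟨fun p => (v.succAbove p.1, v.succAbove p.2),
          fun p q h => by
            simp only [Prod.mk.injEq] at h
            exact Prod.ext (Fin.succAbove_right_injective h.1) (Fin.succAbove_right_injective h.2)⟩ := by
  ext p
  simp only [mem_filter, mem_contactPairs, mem_map, Function.Embedding.coeFn_mk, Function.comp_apply, Prod.exists]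
  constructor
  · rintro ⟨⟨hlt, hd⟩, h1, h2⟩
    obtain ⟨a, ha⟩ := Fin.exists_succAbove_eq h1
    obtain ⟨b, hb⟩ := Fin.exists_succAbove_eq h2
    refine ⟨a, b, ⟨?_, ?_⟩, ?_⟩
    · rw [← Fin.succAbove_lt_succAbove_iff (p := v), ha, hb]; exact hlt
    · rw [ha, hb]; exact hd
    · rw [ha, hb]
  · rintro ⟨a, b, ⟨hlt, hd⟩, rfl⟩
    exact ⟨⟨(Fin.succAbove_lt_succAbove_iff).2 hlt, hd⟩, Fin.succAbove_ne v a, Fin.succAbove_ne v b⟩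

/-- The contact pairs of `x` involving `v` are in bijection with the contact neighbours of `v`. [folklore] -/
theorem card_contactPairs_filter_mem :
    ((contactPairs x).filter (fun p => ¬ (p.1 ≠ v ∧ p.2 ≠ v))).card = coordination x v := by
  classical
  rw [coordination]
  refine card_bij (fun p _ => if p.1 = v then p.2 else p.1) ?_ ?_ ?_
  · intro p hp
    simp only [mem_filter, mem_contactPairs, not_and_or, not_not] at hp
    obtain ⟨⟨hlt, hd⟩, hv⟩ := hp
    simp only [mem_contactNeighbors]
    split_ifs with h1
    · refine ⟨fun h => ?_, by rw [← h1]; exact hd⟩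
      rw [h, ← h1] at hlt; exact lt_irrefl _ hlt
    · rcases hv with h | h
      · exact absurd h h1
      · refine ⟨h1, by rw [← h, dist_comm]; exact hd⟩
  · intro p hp q hq hpq
    simp only [mem_filter, mem_contactPairs, not_and_or, not_not] at hp hq
    obtain ⟨⟨hltp, -⟩, hvp⟩ := hp
    obtain ⟨⟨hltq, -⟩, hvq⟩ := hq
    by_cases hp1 : p.1 = v <;> by_cases hq1 : q.1 = v <;> simp only [hp1, hq1, if_true, if_false] at hpq
    · exact Prod.ext (hp1.trans hq1.symm) hpq
    · -- p = (v, p2), q = (q1, v) with p2 = q1: then v < p2 = q1 < v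
      rcases hvq with h | h
      · exact absurd h hq1
      · exfalso; rw [hp1] at hltp; rw [h] at hltq; rw [hpq] at hltp; exact lt_asymm hltp hltq
    · rcases hvp with h | h
      · exact absurd h hp1
      · exfalso; rw [hq1] at hltq; rw [h] at hltp; rw [← hpq] at hltq; exact lt_asymm hltp hltq
    · rcases hvp with h | h
      · exact absurd h hp1
      · rcases hvq with h' | h'
        · exact absurd h' hq1
        · exact Prod.ext hpq (h.trans h'.symm)
  · intro j hj
    simp only [mem_contactNeighbors] at hj
    obtain ⟨hjv, hd⟩ := hj
    rcases lt_or_gt_of_ne hjv with hlt | hlt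
    · refine ⟨(j, v), ?_, by simp [hjv]⟩
      simp only [mem_filter, mem_contactPairs, not_and_or, not_not]
      exact ⟨⟨hlt, by rw [dist_comm]; exact hd⟩, Or.inr trivial⟩
    · refine ⟨(v, j), ?_, by simp⟩
      simp only [mem_filter, mem_contactPairs, not_and_or, not_not]
      exact ⟨⟨hlt, hd⟩, Or.inl trivial⟩

/-- **Removing a ball.** `C(x) = deg_x(v) + C(x ∘ v.succAbove)`: the contacts of `x` are those at `v` plus those of
the packing with ball `v` removed. [folklore] -/
theorem numContacts_eq_coordination_add :
    numContacts x = coordination x v + numContacts (x ∘ v.succAbove) := by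
  classical
  have h := (card_filter_add_card_filter_not (s := contactPairs x) (fun p => p.1 ≠ v ∧ p.2 ≠ v))
  rw [numContacts, ← h, contactPairs_filter_not_mem, card_map, card_contactPairs_filter_mem, numContacts, add_comm]

end Removal

/-- Removing a ball from a unit packing leaves a unit packing. [folklore] -/
theorem IsUnitPacking.succAbove {x : Fin (N + 1) → EuclideanSpace ℝ (Fin d)} (hx : IsUnitPacking x)
    (v : Fin (N + 1)) : IsUnitPacking (x ∘ v.succAbove) :=
  hx.comp Fin.succAbove_right_injective

/-- **Monotonicity with a loss**: `C(N+1) ≤ C(N) + k` as soon as some maximal packing of `N + 1` balls has a ball with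
at most `k` contacts; in the form used below: for ANY packing `x` of `N+1` balls with a ball of coordination `≤ k`,
`C(x) ≤ k + C(N)`. [folklore] -/
theorem numContacts_le_add_maxContacts {x : Fin (N + 1) → EuclideanSpace ℝ (Fin d)} (hx : IsUnitPacking x)
    {v : Fin (N + 1)} {k : ℕ} (hk : coordination x v ≤ k) : numContacts x ≤ k + maxContacts d N := by
  rw [numContacts_eq_coordination_add x v]
  exact add_le_add hk (numContacts_le_maxContacts (hx.succAbove v))

/-! ### 2. Docking a ball -/

section Docking

variable (x : Fin N → EuclideanSpace ℝ (Fin d)) (q : EuclideanSpace ℝ (Fin d))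

/-- The configuration with a new ball `q` appended (label `Fin.last N`). [folklore] -/
def dock : Fin (N + 1) → EuclideanSpace ℝ (Fin d) := Fin.snoc x q

/-- The docked ball sits at `q`. [folklore] -/
@[simp] theorem dock_last : dock x q (Fin.last N) = q := by simp [dock]

/-- The old balls are unchanged. [folklore] -/
@[simp] theorem dock_castSucc (i : Fin N) : dock x q (Fin.castSucc i) = x i := by simp [dock]

/-- Removing the docked ball recovers `x`. [folklore] -/
theorem dock_comp_succAbove_last : dock x q ∘ (Fin.last N).succAbove = x := by
  ext i : 1
  simp [dock, Fin.succAbove_last]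

/-- Docking a ball at distance `≥ 1` from every centre keeps the packing condition. [folklore] -/
theorem isUnitPacking_dock {x : Fin N → EuclideanSpace ℝ (Fin d)} (hx : IsUnitPacking x)
    {q : EuclideanSpace ℝ (Fin d)} (hq : ∀ i, 1 ≤ dist q (x i)) : IsUnitPacking (dock x q) := by
  intro i j hij
  induction i using Fin.lastCases with
  | last =>
    induction j using Fin.lastCases with
    | last => exact absurd rfl hij
    | cast j => rw [dock_last, dock_castSucc]; exact hq j
  | cast i =>
    induction j using Fin.lastCases with
    | last => rw [dock_last, dock_castSucc, dist_comm]; exact hq i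
    | cast j =>
      rw [dock_castSucc, dock_castSucc]
      exact hx (fun h => hij (by rw [h]))

/-- The new ball's coordination is the number of old centres at distance exactly `1` from `q`. [folklore] -/
theorem coordination_dock_last :
    coordination (dock x q) (Fin.last N) = (univ.filter fun i : Fin N => dist q (x i) = 1).card := by
  classical
  rw [coordination]
  have : contactNeighbors (dock x q) (Fin.last N) =
      (univ.filter fun i : Fin N => dist q (x i) = 1).map Fin.castSuccEmb := by
    ext j
    simp only [mem_contactNeighbors, dock_last, mem_map, mem_filter, mem_univ, true_and, Fin.castSuccEmb_apply]
    constructor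
    · rintro ⟨hj, hd⟩
      obtain ⟨i, rfl⟩ := Fin.exists_castSucc_eq.2 hj
      exact ⟨i, by rw [dock_castSucc] at hd; exact hd, rfl⟩
    · rintro ⟨i, hd, rfl⟩
      exact ⟨(Fin.castSucc_lt_last i).ne, by rw [dock_castSucc]; exact hd⟩
  rw [this, card_map]

/-- **Docking.** `C(dock x q) = #{i : dist q (x i) = 1} + C(x)`. [folklore] -/
theorem numContacts_dock :
    numContacts (dock x q) = (univ.filter fun i : Fin N => dist q (x i) = 1).card + numContacts x := by
  rw [numContacts_eq_coordination_add (dock x q) (Fin.last N), coordination_dock_last, dock_comp_succAbove_last]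

end Docking

/-- **An exposed triangle** of a configuration `x`: a point `q` at distance `≥ 1` from every centre and at distance
exactly `1` from at least three of them — a position where a new ball can be docked gaining `≥ 3` contacts.
(The "exposed triangle" of Bezdek–Khan 2018, proof of Prop. 5.1; a predicate of the configuration, not a cited fact.)
[folklore] -/
def HasExposedTriangle (x : Fin N → EuclideanSpace ℝ (Fin d)) : Prop :=
  ∃ q : EuclideanSpace ℝ (Fin d), (∀ i, 1 ≤ dist q (x i)) ∧ 3 ≤ (univ.filter fun i : Fin N => dist q (x i) = 1).card

/-- Docking at an exposed triangle: a packing of `N + 1` balls with at least `C(x) + 3` contacts; hence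
`C(x) + 3 ≤ C(N+1)`. [folklore] -/
theorem numContacts_add_three_le_maxContacts {x : Fin N → EuclideanSpace ℝ (Fin d)} (hx : IsUnitPacking x)
    (h : HasExposedTriangle x) : numContacts x + 3 ≤ maxContacts d (N + 1) := by
  obtain ⟨q, hq, h3⟩ := h
  have h1 := numContacts_le_maxContacts (isUnitPacking_dock hx hq)
  rw [numContacts_dock] at h1
  omega

/-! ### 3. The kmin induction -/

/-- **The kmin induction.** Let `f : ℕ → ℝ`, `n₀ k₀ : ℕ`. Suppose (i) `C(n) ≤ f n` for `n < n₀`; (ii) `f (n - 1) + k₀ ≤ f n`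
for `n ≥ n₀`; (iii) every unit packing `x` of `n ≥ n₀` balls in `ℝᵈ` (`d ≥ 1`) in which every ball has MORE than
`k₀` contacts satisfies `C(x) ≤ f n`. Then `C(n) ≤ f n` for every `n`. (A ball with `≤ k₀` contacts is removed:
`C(x) ≤ k₀ + C(n−1) ≤ k₀ + f(n−1) ≤ f(n)`.) [folklore] -/
theorem maxContacts_le_of_kmin (hd : 0 < d) (f : ℕ → ℝ) (n₀ k₀ : ℕ)
    (hbase : ∀ n, n < n₀ → (maxContacts d n : ℝ) ≤ f n)
    (hstep : ∀ n, n₀ ≤ n → f (n - 1) + k₀ ≤ f n)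
    (hLP : ∀ n, n₀ ≤ n → ∀ x : Fin n → EuclideanSpace ℝ (Fin d), IsUnitPacking x →
      (∀ i, k₀ < coordination x i) → (numContacts x : ℝ) ≤ f n) :
    ∀ n, (maxContacts d n : ℝ) ≤ f n := by
  intro n
  induction n using Nat.strong_induction_on with
  | _ n ih =>
    rcases lt_or_ge n n₀ with hn | hn
    · exact hbase n hn
    · obtain ⟨x, hx, hxe⟩ := exists_numContacts_eq_maxContacts hd n
      rw [← hxe]
      by_cases hall : ∀ i, k₀ < coordination x i
      · exact hLP n hn x hx hall
      · push Not at hall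
        obtain ⟨v, hv⟩ := hall
        -- n ≥ 1 since Fin n is inhabited
        obtain ⟨m, rfl⟩ : ∃ m, n = m + 1 := ⟨n - 1, by have := v.pos; omega⟩
        have h1 : numContacts x ≤ k₀ + maxContacts d m := numContacts_le_add_maxContacts hx hv
        have h2 : (maxContacts d m : ℝ) ≤ f m := ih m (by omega)
        have h3 := hstep (m + 1) hn
        simp only [Nat.add_sub_cancel] at h3
        calc (numContacts x : ℝ) ≤ k₀ + maxContacts d m := by exact_mod_cast h1
          _ ≤ f (m + 1) := by linarith

/-! ### 4. The Bezdek–Khan induction with the enumeration as hypothesis -/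

/-- **The enumeration hypothesis `E(n)`** (what an exact, complete sweep of the `≥ 3n − 6` stratum certifies): every
unit packing of `n` balls in `ℝ³` with all coordinations `≥ 3` and at least `3n − 6` contacts has exactly `3n − 6`
contacts and an exposed triangle (the hypothesis of Bezdek–Khan 2018, Prop. 5.1: "all maximal contact minimally rigid
packings of n ≤ 9 spheres are listed"; a predicate of `n`, to be DISCHARGED by the cell's certified enumeration, not a
cited fact). [folklore] -/
def EnumerationHypothesis (n : ℕ) : Prop :=
  ∀ x : Fin n → EuclideanSpace ℝ (Fin 3), IsUnitPacking x → (∀ i, 3 ≤ coordination x i) →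
    3 * n - 6 ≤ numContacts x → numContacts x = 3 * n - 6 ∧ HasExposedTriangle x

/-- **Bezdek–Khan, Prop. 5.1, hypothesis-explicit.** Let `4 ≤ n₁ ≤ n₂`. Suppose `C(n₁) = 3n₁ − 6` and every maximal
packing of `n₁` balls has an exposed triangle (base), `E(n)` holds for `n₁ < n ≤ n₂`, and `3n − 6 ≤ C(n)` for
`n₁ ≤ n ≤ n₂` (witnesses). Then for every `n₁ ≤ n ≤ n₂`: `C(n) = 3n − 6` and every maximal packing of `n` balls has
all coordinations `≥ 3` (for `n > n₁`) and an exposed triangle. (Bezdek–Khan, *Contact numbers for sphere packings*,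
2018, Prop. 5.1 — the proof there, with the enumeration as an explicit hypothesis.) [folklore] -/
theorem maxContacts_eq_of_enumeration {n₁ n₂ : ℕ} (h4 : 4 ≤ n₁)
    (hbase : maxContacts 3 n₁ = 3 * n₁ - 6 ∧
      ∀ x : Fin n₁ → EuclideanSpace ℝ (Fin 3), IsUnitPacking x → numContacts x = maxContacts 3 n₁ → HasExposedTriangle x)
    (hE : ∀ n, n₁ < n → n ≤ n₂ → EnumerationHypothesis n)
    (hwit : ∀ n, n₁ ≤ n → n ≤ n₂ → 3 * n - 6 ≤ maxContacts 3 n) :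
    ∀ n, n₁ ≤ n → n ≤ n₂ → maxContacts 3 n = 3 * n - 6 ∧
      ∀ x : Fin n → EuclideanSpace ℝ (Fin 3), IsUnitPacking x → numContacts x = maxContacts 3 n → HasExposedTriangle x := by
  intro n hn1 hn2
  induction n using Nat.strong_induction_on with
  | _ n ih =>
    rcases eq_or_lt_of_le hn1 with rfl | hlt
    · exact hbase
    · obtain ⟨m, rfl⟩ : ∃ m, n = m + 1 := ⟨n - 1, by omega⟩
      have hm1 : n₁ ≤ m := by omega
      obtain ⟨ihC, ihT⟩ := ih m (by omega) hm1 (by omega)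
      -- every maximal packing of m+1 balls has min coordination ≥ 3
      have hmin : ∀ x : Fin (m + 1) → EuclideanSpace ℝ (Fin 3), IsUnitPacking x →
          numContacts x = maxContacts 3 (m + 1) → ∀ i, 3 ≤ coordination x i := by
        intro x hx hxe v
        by_contra hlt2
        push Not at hlt2
        have hv : coordination x v ≤ 2 := by omega
        -- remove v
        have hrem := numContacts_eq_coordination_add x v
        set y := x ∘ v.succAbove with hy
        have hyP : IsUnitPacking y := hx.succAbove v
        have hyle : numContacts y ≤ maxContacts 3 m := numContacts_le_maxContacts hyP
        have hwit' := hwit (m + 1) hn1 hn2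
        rcases lt_or_eq_of_le hyle with hylt | hyeq
        · -- y not maximal: dock at a maximal packing of m balls
          obtain ⟨z, hz, hze⟩ := exists_numContacts_eq_maxContacts (by norm_num : 0 < 3) m
          have hzT := ihT z hz hze
          have := numContacts_add_three_le_maxContacts hz hzT
          omega
        · -- y maximal: it has an exposed triangle; dock v there
          have hyT := ihT y hyP hyeq
          have := numContacts_add_three_le_maxContacts hyP hyT
          omega
      -- apply E(m+1) to a maximal packing
      have hEm := hE (m + 1) hlt hn2
      obtain ⟨x, hx, hxe⟩ := exists_numContacts_eq_maxContacts (by norm_num : 0 < 3) (m + 1)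
      have hw := hwit (m + 1) hn1 hn2
      obtain ⟨hxC, -⟩ := hEm x hx (hmin x hx hxe) (by omega)
      refine ⟨by omega, fun x' hx' hxe' => ?_⟩
      exact (hEm x' hx' (hmin x' hx' hxe') (by omega)).2

end Summit.Ventures.Crystal3D

end
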